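import Literature.MathematicalPhysics.QuantumLattice.GibbsStationaritySlack
import HarnessLib

/-!
# The double-commutator (equations-of-motion / ERPA-stability) row of a ground state:
# `Re ⟨ψ, (Xᴴ[H,X] − [H,X]Xᴴ) ψ⟩ ≥ 0` and `Tr(ρ (Xᴴ[H,X] − [H,X]Xᴴ)) ≥ 0`

Topic `MathematicalPhysics/QuantumLattice`, finite-dimensional; a reader corollary of
`GibbsStationaritySlack.lean` (the ground-state stationarity / KKT rows `⟨ψ,(HA − AH)ψ⟩ = 0` and
`Re ⟨ψ, Aᴴ(HA − AH)ψ⟩ ≥ 0` — Bratteli–Robinson's algebraic ground-state condition `−iω(A⋆δ(A)) ≥ 0`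
for a matrix Hamiltonian; equivalently the «positivity» characterisation of ground states of
Fawzi–Fawzi–Scalet, finite-system case). Here the DOUBLE COMMUTATOR
`[Xᴴ, [H, X]] = Xᴴ(HX − XH) − (HX − XH)Xᴴ` of an arbitrary matrix `X`:

* (private) `conjTranspose_mul_comm_sub_comm_mul_conjTranspose_eq` — the algebra
  `Xᴴ[H,X] − [H,X]Xᴴ = Xᴴ[H,X] + X[H,Xᴴ] − [H, XXᴴ]` (two second-order rows minus one
  first-order row);
* **`re_dotProduct_doubleComm_mulVec_nonneg`** — for Hermitian `H` and a ground-state vector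
  `Hψ = E₀ψ` (`E₀ = H.groundEnergy`): `0 ≤ Re ⟨ψ, (Xᴴ[H,X] − [H,X]Xᴴ)ψ⟩` for EVERY `X`
  (`= ⟨Xψ,(H − E₀)Xψ⟩ + ⟨Xᴴψ,(H − E₀)Xᴴψ⟩`); `_of_isGroundStateVector` form;
* **`trace_mul_doubleComm_nonneg`** — the same for a ground-supported density matrix `ρ ⪰ 0`,
  `Hρ = E₀ρ`: `0 ≤ Tr(ρ(Xᴴ[H,X] − [H,X]Xᴴ))` (in `ℂ` with its partial order: real part `≥ 0`,
  imaginary part `0`).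

WHY A SEPARATE ROW (the use in the chem-oracle cell, LADDER-CHEM I-DIFF door census «G2»): for a
number-conserving ONE-body `X = Σ x_rs a†_r a_s` and a TWO-body Hamiltonian `H`, the single row
`Xᴴ[H,X]` is a THREE-body operator (its expectation needs the 3-RDM), while the double commutator
`[Xᴴ,[H,X]]` is TWO-body — its ground-state expectation is a linear functional of the (γ, Γ) pair,
i.e. an `r² × r²` linear matrix inequality on the 2-RDM that is valid for the ground state, depends on
`H`, and is NOT implied by N-representability (the Rowe equations-of-motion / extended-RPA stability
matrix; in print as machinery, e.g. Chatterjee–Pernal, J. Chem. Phys. 137, 204109 (2012), not as a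
variational 2-RDM constraint). This file supplies only the operator-level soundness statement; the
rank bookkeeping and any 2-RDM row family are NOT formalised here. No definition, no named fact, no
number; everything PROVED from the two cited rows of `GibbsStationaritySlack.lean`.

## References
* O. Bratteli, D. W. Robinson, *Operator Algebras and Quantum Statistical Mechanics II*, 2nd ed.
  (Springer 1997), Def. 5.3.18 / Prop. 5.3.19 (ground states `−iω(A⋆δ(A)) ≥ 0`).
  [cite: BratteliRobinsonII1997, Def 5.3.18 / Prop 5.3.19]
* H. Fawzi, O. Fawzi, S. O. Scalet, *Certified algorithms for equilibrium states of local quantum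
  Hamiltonians*, Nat. Commun. 15 (2024) 7394, §«ground state» (finite systems: `ω(a⋆[H,a]) ≥ 0 ∀a`
  iff `ω` is supported on the ground space). [cite: FawziFawziScalet2024, Definition (ground state) + finite-system remark]
-/

namespace Literature.MathematicalPhysics.QuantumLattice

open Matrix
open scoped ComplexOrder

variable {n : Type*} [Fintype n] [DecidableEq n] {H : Matrix n n ℂ}

omit [DecidableEq n] in
/-- The algebra of the double commutator: `Xᴴ(HX − XH) − (HX − XH)Xᴴ
= Xᴴ(HX − XH) + X(HXᴴ − XᴴH) − (H(XXᴴ) − (XXᴴ)H)` — two second-order (KKT) words, for `A = X`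
and `A = Xᴴ`, minus the first-order word for `A = XXᴴ`. [folklore] -/
private theorem conjTranspose_mul_comm_sub_comm_mul_conjTranspose_eq (H X : Matrix n n ℂ) :
    Xᴴ * (H * X - X * H) - (H * X - X * H) * Xᴴ =
      Xᴴ * (H * X - X * H) + X * (H * Xᴴ - Xᴴ * H) - (H * (X * Xᴴ) - X * Xᴴ * H) := by
  simp only [Matrix.mul_sub, Matrix.sub_mul, Matrix.mul_assoc]
  abel

/-- **Double-commutator (ERPA-stability) row of a ground-state vector.** For Hermitian `H`,
`Hψ = E₀ψ` with `E₀ = H.groundEnergy`, and ANY matrix `X`: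
`0 ≤ Re ⟨ψ, (Xᴴ(HX − XH) − (HX − XH)Xᴴ) ψ⟩` — the sum of the two KKT rows
`Re⟨ψ, Xᴴ[H,X]ψ⟩ ≥ 0`, `Re⟨ψ, X[H,Xᴴ]ψ⟩ ≥ 0` (`re_dotProduct_conjTranspose_comm_mulVec_nonneg`)
and the first-order row `⟨ψ,[H,XXᴴ]ψ⟩ = 0` (`dotProduct_comm_mulVec_eq_zero`).
[cite: BratteliRobinsonII1997, Def 5.3.18 / Prop 5.3.19 (ground states)] -/
theorem re_dotProduct_doubleComm_mulVec_nonneg (hH : H.IsHermitian) {ψ : n → ℂ}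
    (hψ : H *ᵥ ψ = (H.groundEnergy : ℂ) • ψ) (X : Matrix n n ℂ) :
    0 ≤ (star ψ ⬝ᵥ (Xᴴ * (H * X - X * H) - (H * X - X * H) * Xᴴ) *ᵥ ψ).re := by
  have h1 := re_dotProduct_conjTranspose_comm_mulVec_nonneg hH hψ X
  have h2 := re_dotProduct_conjTranspose_comm_mulVec_nonneg hH hψ Xᴴ
  rw [Matrix.conjTranspose_conjTranspose] at h2
  have h3 := dotProduct_comm_mulVec_eq_zero hH hψ (X * Xᴴ)
  rw [conjTranspose_mul_comm_sub_comm_mul_conjTranspose_eq, Matrix.sub_mulVec, Matrix.add_mulVec,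
    dotProduct_sub, dotProduct_add, h3, sub_zero, Complex.add_re]
  exact add_nonneg h1 h2

/-- The same for a ground-state vector in the tree's vocabulary `Matrix.IsGroundStateVector`
(`ψ ≠ 0 ∧ Hψ = E₀ψ`). [cite: BratteliRobinsonII1997, Def 5.3.18 / Prop 5.3.19 (ground states)] -/
theorem re_dotProduct_doubleComm_mulVec_nonneg_of_isGroundStateVector (hH : H.IsHermitian)
    {ψ : n → ℂ} (hψ : H.IsGroundStateVector ψ) (X : Matrix n n ℂ) :
    0 ≤ (star ψ ⬝ᵥ (Xᴴ * (H * X - X * H) - (H * X - X * H) * Xᴴ) *ᵥ ψ).re :=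
  re_dotProduct_doubleComm_mulVec_nonneg hH hψ.2 X

/-- **Double-commutator row of a ground-supported density matrix** (every mixed ground state):
`ρ ⪰ 0`, `Hρ = E₀ρ` with `E₀ = H.groundEnergy` ⇒ `0 ≤ Tr(ρ (Xᴴ(HX − XH) − (HX − XH)Xᴴ))` for every
`X`, from `trace_mul_conjTranspose_comm_mul_nonneg` (for `X` and `Xᴴ`) and
`trace_mul_comm_eq_zero_of_hamiltonian_mul_eq_smul` (for `XXᴴ`).
[cite: BratteliRobinsonII1997, Def 5.3.18 / Prop 5.3.19 (ground states)] -/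
theorem trace_mul_doubleComm_nonneg (hH : H.IsHermitian) {ρ : Matrix n n ℂ} (hρ : ρ.PosSemidef)
    (hHρ : H * ρ = (H.groundEnergy : ℂ) • ρ) (X : Matrix n n ℂ) :
    0 ≤ (ρ * (Xᴴ * (H * X - X * H) - (H * X - X * H) * Xᴴ)).trace := by
  have h1 := trace_mul_conjTranspose_comm_mul_nonneg hH hρ hHρ X
  have h2 := trace_mul_conjTranspose_comm_mul_nonneg hH hρ hHρ Xᴴ
  rw [Matrix.conjTranspose_conjTranspose] at h2
  have h3 := trace_mul_comm_eq_zero_of_hamiltonian_mul_eq_smul hH hρ.isHermitian hHρ (X * Xᴴ)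
  rw [conjTranspose_mul_comm_sub_comm_mul_conjTranspose_eq, Matrix.mul_sub, Matrix.mul_add,
    Matrix.trace_sub, Matrix.trace_add, h3, sub_zero]
  exact add_nonneg h1 h2

end Literature.MathematicalPhysics.QuantumLattice
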